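import Literature.Analysis.FluidPDE.PassiveScalarExistenceApprox
import HarnessLib

/-!
# Smooth divergence-free approximation of a square-integrable drift

Analysis/FluidPDE proof-support file (everything proved): the regularisation step of
DiPerna–Lions 1989, proof of Prop. II.1, for drifts that are merely square integrable on
`(0,T) × T^d` (the velocity class of Leray–Hopf fields), weakening the boundedness hypothesis of
`exists_smooth_isDivFree_tendsto_eLpNorm_sub` (`PassiveScalarExistenceApprox`), whose construction
(space–time mollification of a strongly measurable representative of `u 1_{(0,T)}`) only ever
used `u ∈ L²`. Output: fields `vₙ` with `C^∞` space–time lifts and divergence-free slices,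
`vₙ → u` in `L²((0,T) × T^d)` (`exists_smooth_isDivFree_tendsto_eLpNorm_sub_of_sq`).

## References

* R. J. DiPerna, P.-L. Lions, Invent. Math. 98 (1989), 511–547, proof of Prop. II.1.
  [`DiPernaLions1989`]
-/

noncomputable section

open _root_.MeasureTheory _root_.TopologicalSpace _root_.Set _root_.Function _root_.Filter _root_.Metric
open _root_.Topology
open scoped ENNReal NNReal Convolution InnerProductSpace ContDiff

namespace Literature.Analysis.FluidPDE

namespace Torus

variable {d : Type*} [Fintype d]

/-! ## Regularisation of a square-integrable drift -/

section Drift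

variable [DecidableEq d]

/-- **Smooth divergence-free approximation of a square-integrable weakly divergence-free
drift** (DiPerna–Lions 1989, proof of Prop. II.1: the coefficient `b` is regularised by
convolution; here mollified in space and time): let `u : (0,T) × T^d → ℝ^d` be space–time
measurable, square integrable (`∫₀ᵀ∫‖u‖² < ∞`) and weakly divergence free at a.e. time. Then
there are fields `vₙ` with `C^∞` space–time lifts, all of whose time slices are divergence free,
converging to `u` in `L²((0,T) × T^d)`. This is `exists_smooth_isDivFree_tendsto_eLpNorm_sub` of
`PassiveScalarExistenceApprox` with the boundedness of `u` weakened to square integrability (the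
construction only ever used `u ∈ L²`). [cite: DiPernaLions1989, Prop. II.1, proof] -/
theorem exists_smooth_isDivFree_tendsto_eLpNorm_sub_of_sq {T : ℝ} {u : ℝ → UnitAddTorus d → EuclideanSpace ℝ d}
    (hum : AEStronglyMeasurable (FunctionSpaces.Torus.stLift u) (volume.restrict (Ioo 0 T ×ˢ univ)))
    (hu2 : ∫⁻ t in Ioo 0 T, ∫⁻ x, ‖u t x‖ₑ ^ 2 < ⊤)
    (hdiv : ∀ᵐ t ∂(volume.restrict (Ioo 0 T)), FunctionSpaces.Torus.IsWeaklyDivFree (u t)) :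
    ∃ v : ℕ → ℝ → UnitAddTorus d → EuclideanSpace ℝ d,
      (∀ n, ContDiff ℝ ∞ (FunctionSpaces.Torus.stLift (v n))) ∧
      (∀ n t, FunctionSpaces.Torus.IsDivFree (v n t)) ∧
      Tendsto (fun n => eLpNorm (fun q : ℝ × UnitAddTorus d => v n q.1 q.2 - u q.1 q.2) 2
        (((volume : Measure ℝ).restrict (Ioo 0 T)).prod volume)) atTop (𝓝 0) := by
  -- a strongly measurable representative of `u 1_{(0,T)}`
  have hum' : AEStronglyMeasurable (uncurry u) (volume.restrict (Ioo 0 T ×ˢ (univ : Set (UnitAddTorus d)))) :=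
    FunctionSpaces.Torus.aestronglyMeasurable_uncurry_of_stLift_restrict hum
  obtain ⟨U, hUm, hU0, hUae, hUu⟩ := exists_stronglyMeasurable_representative hum'
  have hU2 : MemLp (uncurry U) 2 ((volume : Measure ℝ).prod volume) :=
    memLp_two_representative hUm hU0 hUu hu2
  have hUi : Integrable (uncurry U) ((volume : Measure ℝ).prod volume) := integrable_representative hU0 hU2
  have hUdiv : ∀ᵐ s ∂(volume : Measure ℝ), FunctionSpaces.Torus.IsWeaklyDivFree (U s) :=
    ae_isWeaklyDivFree_representative hU0 hUu hdiv
  -- parameters: time bumps of radius `→ 0`, space radii `εₘ = 1/(4(m+1))`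
  obtain ⟨φ, -, hφ⟩ := exists_contDiffBump_seq_rOut one_pos
  obtain ⟨hpos, hle, hlim⟩ := molRadius_spec
  set ε : ℕ → ℝ := fun m => 1 / (4 * ((m : ℝ) + 1)) with hε
  -- diagonal choice of the time radius
  have hA : ∀ m, ∃ N : ℕ, eLpNorm (fun q : ℝ × UnitAddTorus d =>
      FunctionSpaces.Torus.mollifiedField (φ N) (ε m) U q.1 q.2 - FunctionSpaces.Torus.vecMollify (ε m) (U q.1) q.2) 2
        ((volume : Measure ℝ).prod volume) ≤ ENNReal.ofReal (ε m) := by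
    intro m
    have h := tendsto_eLpNorm_mollifiedField_sub hUm hUi hU2 (hpos m) (hle m) hφ
    obtain ⟨N, hN⟩ := (ENNReal.tendsto_atTop_zero.1 h) (ENNReal.ofReal (ε m)) (ENNReal.ofReal_pos.2 (hpos m))
    exact ⟨N, hN N le_rfl⟩
  choose N hN using hA
  have hAlim : Tendsto (fun m => eLpNorm (fun q : ℝ × UnitAddTorus d =>
      FunctionSpaces.Torus.mollifiedField (φ (N m)) (ε m) U q.1 q.2 - FunctionSpaces.Torus.vecMollify (ε m) (U q.1) q.2) 2
        ((volume : Measure ℝ).prod volume)) atTop (𝓝 0) := by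
    have h0 : Tendsto (fun m => ENNReal.ofReal (ε m)) atTop (𝓝 0) := by
      rw [← ENNReal.ofReal_zero]
      exact ENNReal.tendsto_ofReal hlim
    exact tendsto_of_tendsto_of_tendsto_of_le_of_le tendsto_const_nhds h0 (fun m => zero_le) hN
  have hBlim := tendsto_eLpNorm_vecMollify_uncurry_sub hUm hU2
  -- the approximating fields
  set v : ℕ → ℝ → UnitAddTorus d → EuclideanSpace ℝ d := fun m => FunctionSpaces.Torus.mollifiedField (φ (N m)) (ε m) U
    with hv
  refine ⟨v, fun m => contDiff_stLift_mollifiedField hUi (hpos m) (hle m),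
    fun m t => isDivFree_mollifiedField hUi hUdiv (hpos m) (hle m) t, ?_⟩
  -- measurability of the pieces
  have hvm : ∀ m, StronglyMeasurable (uncurry (v m)) := fun m =>
    (continuous_uncurry_mollifiedField hUi (hpos m) (hle m)).stronglyMeasurable
  have hwm : ∀ m, AEStronglyMeasurable (fun q : ℝ × UnitAddTorus d => FunctionSpaces.Torus.vecMollify (ε m) (U q.1) q.2)
      ((volume : Measure ℝ).prod volume) := by
    intro m
    have h : ∀ i, StronglyMeasurable (uncurry fun s x => ((fun y => U s y i) ⋆ FunctionSpaces.Torus.kernel (ε m)) x) :=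
      fun i => stronglyMeasurable_uncurry_convolution (stronglyMeasurable_uncurry_apply hUm i)
        (FunctionSpaces.Torus.continuous_kernel (hpos m) (hle m))
    have h' : (fun q : ℝ × UnitAddTorus d => FunctionSpaces.Torus.vecMollify (ε m) (U q.1) q.2) =
        fun q => WithLp.toLp 2 fun i => (uncurry fun s x => ((fun y => U s y i) ⋆ FunctionSpaces.Torus.kernel (ε m)) x) q := by
      funext q; rfl
    rw [h']
    exact ((PiLp.continuous_toLp 2 _).measurable.comp
      (measurable_pi_iff.2 fun i => (h i).measurable)).aestronglyMeasurable
  -- `‖v m - u‖_{L²((0,T)×T^d)} = ‖v m - U‖_{L²((0,T)×T^d)} ≤ ‖v m - U‖_{L²(ℝ×T^d)} ≤ ‖v m - u^ε‖ + ‖u^ε - U‖`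
  have hμle : ((volume : Measure ℝ).restrict (Ioo 0 T)).prod (volume : Measure (UnitAddTorus d)) ≤
      (volume : Measure ℝ).prod volume := by
    rw [← Measure.restrict_univ (μ := (volume : Measure (UnitAddTorus d))), Measure.prod_restrict,
      Measure.restrict_univ]
    exact Measure.restrict_le_self
  have hUu' : (fun q : ℝ × UnitAddTorus d => U q.1 q.2) =ᵐ[((volume : Measure ℝ).restrict (Ioo 0 T)).prod volume]
      fun q => u q.1 q.2 := by
    have h1 : uncurry U =ᵐ[volume.restrict (Ioo 0 T ×ˢ (univ : Set (UnitAddTorus d)))]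
        (Ioo 0 T ×ˢ univ).indicator (uncurry u) := ae_restrict_of_ae hUae
    have h2 : (Ioo 0 T ×ˢ (univ : Set (UnitAddTorus d))).indicator (uncurry u)
        =ᵐ[volume.restrict (Ioo 0 T ×ˢ (univ : Set (UnitAddTorus d)))] uncurry u :=
      indicator_ae_eq_restrict (measurableSet_Ioo.prod MeasurableSet.univ)
    have h3 := h1.trans h2
    rw [volume_restrict_prod_eq] at h3
    exact h3
  have hkey : ∀ m, eLpNorm (fun q : ℝ × UnitAddTorus d => v m q.1 q.2 - u q.1 q.2) 2
      (((volume : Measure ℝ).restrict (Ioo 0 T)).prod volume) ≤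
      eLpNorm (fun q : ℝ × UnitAddTorus d =>
        FunctionSpaces.Torus.mollifiedField (φ (N m)) (ε m) U q.1 q.2 - FunctionSpaces.Torus.vecMollify (ε m) (U q.1) q.2) 2
        ((volume : Measure ℝ).prod volume) +
      eLpNorm (fun q : ℝ × UnitAddTorus d =>
        FunctionSpaces.Torus.vecMollify (ε m) (U q.1) q.2 - U q.1 q.2) 2 ((volume : Measure ℝ).prod volume) := by
    intro m
    calc eLpNorm (fun q : ℝ × UnitAddTorus d => v m q.1 q.2 - u q.1 q.2) 2
          (((volume : Measure ℝ).restrict (Ioo 0 T)).prod volume)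
        = eLpNorm (fun q : ℝ × UnitAddTorus d => v m q.1 q.2 - U q.1 q.2) 2
          (((volume : Measure ℝ).restrict (Ioo 0 T)).prod volume) := by
          refine eLpNorm_congr_ae ?_
          filter_upwards [hUu'] with q hq
          rw [hq]
      _ ≤ eLpNorm (fun q : ℝ × UnitAddTorus d => v m q.1 q.2 - U q.1 q.2) 2 ((volume : Measure ℝ).prod volume) :=
          eLpNorm_mono_measure _ hμle
      _ = eLpNorm ((fun q : ℝ × UnitAddTorus d =>
            FunctionSpaces.Torus.mollifiedField (φ (N m)) (ε m) U q.1 q.2 - FunctionSpaces.Torus.vecMollify (ε m) (U q.1) q.2) +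
            fun q : ℝ × UnitAddTorus d => FunctionSpaces.Torus.vecMollify (ε m) (U q.1) q.2 - U q.1 q.2) 2
          ((volume : Measure ℝ).prod volume) := by
          congr 1
          funext q
          simp only [Pi.add_apply, hv, sub_add_sub_cancel]
      _ ≤ _ := eLpNorm_add_le (((hvm m).aestronglyMeasurable.sub (hwm m))) ((hwm m).sub hUm.aestronglyMeasurable) one_le_two
  have hsum : Tendsto (fun m => eLpNorm (fun q : ℝ × UnitAddTorus d =>
        FunctionSpaces.Torus.mollifiedField (φ (N m)) (ε m) U q.1 q.2 - FunctionSpaces.Torus.vecMollify (ε m) (U q.1) q.2) 2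
        ((volume : Measure ℝ).prod volume) +
      eLpNorm (fun q : ℝ × UnitAddTorus d =>
        FunctionSpaces.Torus.vecMollify (ε m) (U q.1) q.2 - U q.1 q.2) 2 ((volume : Measure ℝ).prod volume)) atTop (𝓝 0) := by
    have h := hAlim.add hBlim
    rwa [add_zero] at h
  exact tendsto_of_tendsto_of_tendsto_of_le_of_le tendsto_const_nhds hsum (fun m => zero_le) hkey


end Drift

end Torus

end Literature.Analysis.FluidPDE

end
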